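import Summits.Ventures.ManinGamma.GLCore
import Summits.Ventures.ManinGamma.GLCoreCoprime

/-!
# Theorem GL (full statement): `Γ₁(N)` is generated by its parabolic elements together with any `Γ(M)`, `N ∣ M`

Blind cell `pub-manin-gamma0`, seat p3 (generation 2).  Paper reference: `proofs/GL_congruence_kernel_p3.md`, Theorem GL
(= Fricke–Wohlfahrt, as quoted in Stevens 1989, p. 82).  We prove, for every `N ≥ 1`, every `M ≥ 1` with `N ∣ M`, and every
subgroup `P ≤ SL(2,ℤ)` containing all elements of `Γ₁(N)` of trace `2` (the parabolic = unipotent elements of `Γ₁(N)`, and `1`):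

  `Γ₁(N) ≤ P ⊔ Γ(M)`   (`Gamma1_le_sup_Gamma`),

and the corollary used by the route (GL-a): a subgroup containing some `Γ(M)`, `M ≥ 1`, and all trace-2 elements of `Γ₁(N)`
contains `Γ₁(N)` (`Gamma1_le_of_Gamma_le`).  The proof is the induction of the paper: the finite cores are
`ManinGamma.GLCore.mem_closure_unipotent` (step `M' ↦ M'p` with `p ∣ M'`) and
`ManinGamma.GLCoreB.mem_closure_unipotent_coprime` (step with `p ∤ M'`), applied with `N` replaced by `M'`.
Only Mathlib and the two cell files above are imported; no definitions are introduced.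
-/

namespace ManinGamma
namespace GLFull

open Matrix
open scoped MatrixGroups

/-- The reduction map `SL(2,ℤ) → SL(2, ℤ/mℤ)` on entries. -/
theorem red_apply (m : ℕ) (γ : SL(2, ℤ)) (i j : Fin 2) :
    ((Matrix.SpecialLinearGroup.map (Int.castRingHom (ZMod m)) γ : SL(2, ZMod m)) :
      Matrix (Fin 2) (Fin 2) (ZMod m)) i j = ((γ i j : ℤ) : ZMod m) := by
  simp

/-- `Γ(M') ≤ Γ(M)` when `M ∣ M'`. -/
theorem Gamma_le_Gamma_of_dvd {M M' : ℕ} (h : M ∣ M') :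
    CongruenceSubgroup.Gamma M' ≤ CongruenceSubgroup.Gamma M := by
  intro γ hγ
  rw [CongruenceSubgroup.Gamma_mem] at hγ ⊢
  obtain ⟨h₁, h₂, h₃, h₄⟩ := hγ
  have key : ∀ x : ℤ, ∀ y : ℕ, ((x : ℤ) : ZMod M') = (y : ZMod M') → ((x : ℤ) : ZMod M) = (y : ZMod M) := by
    intro x y hxy
    have e := congrArg (ZMod.castHom h (ZMod M)) hxy
    rwa [map_intCast, map_natCast] at e
  refine ⟨?_, ?_, ?_, ?_⟩
  · simpa using key _ 1 (by simpa using h₁)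
  · simpa using key _ 0 (by simpa using h₂)
  · simpa using key _ 0 (by simpa using h₃)
  · simpa using key _ 1 (by simpa using h₄)

/-- `Γ₁(M') ≤ Γ₁(N)` when `N ∣ M'`. -/
theorem Gamma1_le_Gamma1_of_dvd {N M' : ℕ} (h : N ∣ M') :
    CongruenceSubgroup.Gamma1 M' ≤ CongruenceSubgroup.Gamma1 N := by
  intro γ hγ
  rw [CongruenceSubgroup.Gamma1_mem] at hγ ⊢
  obtain ⟨h₁, h₂, h₃⟩ := hγ
  have key : ∀ x : ℤ, ∀ y : ℕ, ((x : ℤ) : ZMod M') = (y : ZMod M') → ((x : ℤ) : ZMod N) = (y : ZMod N) := by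
    intro x y hxy
    have e := congrArg (ZMod.castHom h (ZMod N)) hxy
    rwa [map_intCast, map_natCast] at e
  refine ⟨?_, ?_, ?_⟩
  · simpa using key _ 1 (by simpa using h₁)
  · simpa using key _ 1 (by simpa using h₂)
  · simpa using key _ 0 (by simpa using h₃)

/-- If two elements of `SL(2,ℤ)` have the same reduction modulo `m`, their quotient lies in `Γ(m)`. -/
theorem inv_mul_mem_Gamma_of_red_eq {m : ℕ} {π h : SL(2, ℤ)}
    (e : Matrix.SpecialLinearGroup.map (Int.castRingHom (ZMod m)) π =
      Matrix.SpecialLinearGroup.map (Int.castRingHom (ZMod m)) h) :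
    π⁻¹ * h ∈ CongruenceSubgroup.Gamma m := by
  rw [CongruenceSubgroup.Gamma_mem', map_mul, map_inv, e, inv_mul_cancel]

/-- An integer congruent to `r` mod `M'` is `r + M'·a`; cast to `ℤ/mℤ`. -/
theorem exists_eq_add_mul_of_cast_eq {M' : ℕ} (m : ℕ) (x r : ℤ) (hx : ((x : ℤ) : ZMod M') = (r : ZMod M')) :
    ∃ a : ZMod m, ((x : ℤ) : ZMod m) = (r : ZMod m) + (M' : ZMod m) * a := by
  have h0 : (((x - r : ℤ)) : ZMod M') = 0 := by push_cast; rw [hx, sub_self]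
  obtain ⟨k, hk⟩ := (ZMod.intCast_zmod_eq_zero_iff_dvd (x - r) M').mp h0
  refine ⟨(k : ZMod m), ?_⟩
  have : x = r + (M' : ℤ) * k := by linarith
  rw [this]; push_cast; ring

/-- The base case `M = N`: `Γ₁(N) ≤ P ⊔ Γ(N)` (reduce by a power of `T`). -/
theorem base_case {N : ℕ} (P : Subgroup SL(2, ℤ))
    (hP : ∀ γ : SL(2, ℤ), γ ∈ CongruenceSubgroup.Gamma1 N → (γ : Matrix (Fin 2) (Fin 2) ℤ).trace = 2 → γ ∈ P)
    (γ : SL(2, ℤ)) (hγ : γ ∈ CongruenceSubgroup.Gamma1 N) :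
    ∃ π ∈ P, π⁻¹ * γ ∈ CongruenceSubgroup.Gamma N := by
  have hT : ModularGroup.T ∈ P := by
    refine hP _ ((CongruenceSubgroup.Gamma1_mem N _).mpr ?_) ?_
    · simp [ModularGroup.coe_T]
    · rw [ModularGroup.coe_T, Matrix.trace_fin_two]; simp
  refine ⟨ModularGroup.T ^ ((γ 0 1 : ℤ)), Subgroup.zpow_mem _ hT _, ?_⟩
  rw [CongruenceSubgroup.Gamma1_mem] at hγ
  obtain ⟨h₁, h₂, h₃⟩ := hγ
  rw [CongruenceSubgroup.Gamma_mem]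
  have hcoe : ((ModularGroup.T ^ ((γ 0 1 : ℤ)))⁻¹ * γ : SL(2, ℤ)).1 =
      !![(γ 0 0 : ℤ) - (γ 0 1 : ℤ) * (γ 1 0 : ℤ), (γ 0 1 : ℤ) - (γ 0 1 : ℤ) * (γ 1 1 : ℤ);
         (γ 1 0 : ℤ), (γ 1 1 : ℤ)] := by
    rw [← _root_.zpow_neg, Matrix.SpecialLinearGroup.coe_mul, ModularGroup.coe_T_zpow]
    ext i j
    fin_cases i <;> fin_cases j <;> simp [Matrix.mul_apply, Fin.sum_univ_two] <;> ring
  have e : ∀ i j : Fin 2, (((ModularGroup.T ^ ((γ 0 1 : ℤ)))⁻¹ * γ : SL(2, ℤ)) i j : ℤ) =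
      !![(γ 0 0 : ℤ) - (γ 0 1 : ℤ) * (γ 1 0 : ℤ), (γ 0 1 : ℤ) - (γ 0 1 : ℤ) * (γ 1 1 : ℤ);
         (γ 1 0 : ℤ), (γ 1 1 : ℤ)] i j := by
    intro i j; rw [← hcoe]
  refine ⟨?_, ?_, ?_, ?_⟩
  · rw [e]; simp only [Matrix.of_apply, Matrix.cons_val', Matrix.cons_val_zero, Matrix.cons_val_fin_one]
    push_cast; rw [h₁, h₃]; ring
  · rw [e]; simp only [Matrix.of_apply, Matrix.cons_val', Matrix.cons_val_zero, Matrix.cons_val_one,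
      Matrix.cons_val_fin_one]
    push_cast; rw [h₂]; ring
  · rw [e]; simp only [Matrix.of_apply, Matrix.cons_val', Matrix.cons_val_zero, Matrix.cons_val_one,
      Matrix.cons_val_fin_one]
    exact h₃
  · rw [e]; simp only [Matrix.of_apply, Matrix.cons_val', Matrix.cons_val_one, Matrix.cons_val_fin_one]
    exact h₂


/-- The induction step `M' ↦ M'·p`: an element of `Γ(M')` (`N ∣ M'`) is, modulo `Γ(M' p)`, a product of parabolic
elements of `Γ₁(N)`.  Uses the two finite cores with `N` replaced by `M'`. -/
theorem step {N M' : ℕ} (p : ℕ) (hp : p.Prime) (hNM' : N ∣ M') (hM' : 0 < M') (P : Subgroup SL(2, ℤ))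
    (hP : ∀ γ : SL(2, ℤ), γ ∈ CongruenceSubgroup.Gamma1 N → (γ : Matrix (Fin 2) (Fin 2) ℤ).trace = 2 → γ ∈ P)
    (h : SL(2, ℤ)) (hh : h ∈ CongruenceSubgroup.Gamma M') :
    ∃ π ∈ P, π⁻¹ * h ∈ CongruenceSubgroup.Gamma (M' * p) := by
  haveI : NeZero M' := ⟨hM'.ne'⟩
  haveI : Fact p.Prime := ⟨hp⟩
  haveI : NeZero (M' * p) := ⟨Nat.mul_ne_zero hM'.ne' hp.ne_zero⟩
  obtain ⟨T, V, U, hT, hV, hU⟩ := GLCore.unipotent_generators_exist (M' : ℤ)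
  -- the three lifts are parabolic elements of Γ₁(M') ≤ Γ₁(N), hence lie in P
  have memP : ∀ A : SL(2, ℤ), ((A : Matrix (Fin 2) (Fin 2) ℤ) = !![1, 1; 0, 1] ∨
      (A : Matrix (Fin 2) (Fin 2) ℤ) = !![1, 0; (M' : ℤ), 1] ∨
      (A : Matrix (Fin 2) (Fin 2) ℤ) = !![1 + (M' : ℤ), (M' : ℤ); -(M' : ℤ), 1 - (M' : ℤ)]) → A ∈ P := by
    intro A hA
    obtain ⟨h1, h2⟩ := GLCore.unipotent_lifts_mem_Gamma1 M' A hA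
    exact hP A (Gamma1_le_Gamma1_of_dvd hNM' h1) h2
  have hTP : T ∈ P := memP T (Or.inl hT)
  have hVP : V ∈ P := memP V (Or.inr (Or.inl hV))
  have hUP : U ∈ P := memP U (Or.inr (Or.inr hU))
  -- reductions modulo M' p
  have hT' : ((Matrix.SpecialLinearGroup.map (Int.castRingHom (ZMod (M' * p))) T : SL(2, ZMod (M' * p))) :
      Matrix (Fin 2) (Fin 2) (ZMod (M' * p))) = !![1, 1; 0, 1] := by
    rw [Matrix.SpecialLinearGroup.map_apply_coe, hT]
    ext i j; fin_cases i <;> fin_cases j <;> simp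
  have hV' : ((Matrix.SpecialLinearGroup.map (Int.castRingHom (ZMod (M' * p))) V : SL(2, ZMod (M' * p))) :
      Matrix (Fin 2) (Fin 2) (ZMod (M' * p))) = !![1, 0; ((M' : ℕ) : ZMod (M' * p)), 1] := by
    rw [Matrix.SpecialLinearGroup.map_apply_coe, hV]
    ext i j; fin_cases i <;> fin_cases j <;> simp
  have hU' : ((Matrix.SpecialLinearGroup.map (Int.castRingHom (ZMod (M' * p))) U : SL(2, ZMod (M' * p))) :
      Matrix (Fin 2) (Fin 2) (ZMod (M' * p))) =
      !![1 + ((M' : ℕ) : ZMod (M' * p)), ((M' : ℕ) : ZMod (M' * p)); -((M' : ℕ) : ZMod (M' * p)),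
        1 - ((M' : ℕ) : ZMod (M' * p))] := by
    rw [Matrix.SpecialLinearGroup.map_apply_coe, hU]
    ext i j; fin_cases i <;> fin_cases j <;> simp
  -- entries of the reduction of h
  rw [CongruenceSubgroup.Gamma_mem] at hh
  obtain ⟨e₁, -, e₃, e₄⟩ := hh
  obtain ⟨a, ha⟩ := exists_eq_add_mul_of_cast_eq (M' := M') (M' * p) (h 0 0 : ℤ) 1 (by simpa using e₁)
  obtain ⟨c, hc⟩ := exists_eq_add_mul_of_cast_eq (M' := M') (M' * p) (h 1 0 : ℤ) 0 (by simpa using e₃)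
  obtain ⟨d, hd⟩ := exists_eq_add_mul_of_cast_eq (M' := M') (M' * p) (h 1 1 : ℤ) 1 (by simpa using e₄)
  have h₀₀ : ((Matrix.SpecialLinearGroup.map (Int.castRingHom (ZMod (M' * p))) h : SL(2, ZMod (M' * p))) :
      Matrix (Fin 2) (Fin 2) (ZMod (M' * p))) 0 0 = 1 + ((M' : ℕ) : ZMod (M' * p)) * a := by
    rw [red_apply, ha]; push_cast; ring
  have h₀₁ : ((Matrix.SpecialLinearGroup.map (Int.castRingHom (ZMod (M' * p))) h : SL(2, ZMod (M' * p))) :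
      Matrix (Fin 2) (Fin 2) (ZMod (M' * p))) 0 1 = ((h 0 1 : ℤ) : ZMod (M' * p)) := red_apply _ _ _ _
  have h₁₀ : ((Matrix.SpecialLinearGroup.map (Int.castRingHom (ZMod (M' * p))) h : SL(2, ZMod (M' * p))) :
      Matrix (Fin 2) (Fin 2) (ZMod (M' * p))) 1 0 = ((M' : ℕ) : ZMod (M' * p)) * c := by
    rw [red_apply, hc]; push_cast; ring
  have h₁₁ : ((Matrix.SpecialLinearGroup.map (Int.castRingHom (ZMod (M' * p))) h : SL(2, ZMod (M' * p))) :
      Matrix (Fin 2) (Fin 2) (ZMod (M' * p))) 1 1 = 1 + ((M' : ℕ) : ZMod (M' * p)) * d := by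
    rw [red_apply, hd]; push_cast; ring
  -- the finite core: the reduction of h lies in the image of P
  have hmem : Matrix.SpecialLinearGroup.map (Int.castRingHom (ZMod (M' * p))) h ∈
      P.map (Matrix.SpecialLinearGroup.map (Int.castRingHom (ZMod (M' * p)))) := by
    by_cases hpM : p ∣ M'
    · have hsq : ((M' : ℕ) : ZMod (M' * p)) * ((M' : ℕ) : ZMod (M' * p)) = 0 := by
        obtain ⟨q, hq⟩ := hpM
        have h0 : ((M' * p : ℕ) : ZMod (M' * p)) = 0 := ZMod.natCast_self _
        have : ((M' : ℕ) : ZMod (M' * p)) * ((M' : ℕ) : ZMod (M' * p)) =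
            ((M' * p : ℕ) : ZMod (M' * p)) * (q : ZMod (M' * p)) := by
          conv_lhs => rw [show ((M' : ℕ) : ZMod (M' * p)) * ((M' : ℕ) : ZMod (M' * p)) =
            ((M' : ℕ) : ZMod (M' * p)) * ((p * q : ℕ) : ZMod (M' * p)) by rw [← hq]]
          push_cast; ring
        rw [this, h0, zero_mul]
      have key := GLCore.mem_closure_unipotent (m := M' * p) ((M' : ℕ) : ZMod (M' * p)) hsq _ _ _ _
        hT' hV' hU' a _ c d h₀₀ h₀₁ h₁₀ h₁₁
      refine (Subgroup.closure_le _).mpr ?_ key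
      intro x hx
      simp only [Set.mem_insert_iff, Set.mem_singleton_iff] at hx
      rcases hx with rfl | rfl | rfl
      · exact Subgroup.mem_map_of_mem _ hTP
      · exact Subgroup.mem_map_of_mem _ hVP
      · exact Subgroup.mem_map_of_mem _ hUP
    · have key := GLCoreB.mem_closure_unipotent_coprime (N := M') (p := p) hpM _ _ _
        hT' hV' a _ c d h₀₀ h₀₁ h₁₀ h₁₁
      refine (Subgroup.closure_le _).mpr ?_ key
      intro x hx
      simp only [Set.mem_insert_iff, Set.mem_singleton_iff] at hx
      rcases hx with rfl | rfl
      · exact Subgroup.mem_map_of_mem _ hTP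
      · exact Subgroup.mem_map_of_mem _ hVP
  obtain ⟨π, hπP, hπ⟩ := Subgroup.mem_map.mp hmem
  exact ⟨π, hπP, inv_mul_mem_Gamma_of_red_eq hπ⟩

/-- The induction on `k = M/N`: every element of `Γ₁(N)` is, modulo `Γ(N k)`, an element of `P`. -/
theorem exists_mem_inv_mul_mem_Gamma {N : ℕ} (hN : 0 < N) (P : Subgroup SL(2, ℤ))
    (hP : ∀ γ : SL(2, ℤ), γ ∈ CongruenceSubgroup.Gamma1 N → (γ : Matrix (Fin 2) (Fin 2) ℤ).trace = 2 → γ ∈ P)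
    (k : ℕ) (hk : 0 < k) (γ : SL(2, ℤ)) (hγ : γ ∈ CongruenceSubgroup.Gamma1 N) :
    ∃ π ∈ P, π⁻¹ * γ ∈ CongruenceSubgroup.Gamma (N * k) := by
  induction k using Nat.strong_induction_on generalizing γ with
  | _ k ih =>
    by_cases hk1 : k = 1
    · subst hk1
      rw [mul_one]
      exact base_case P hP γ hγ
    · obtain ⟨p, hpdef⟩ : ∃ p, p = Nat.minFac k := ⟨_, rfl⟩
      have hp : p.Prime := hpdef ▸ Nat.minFac_prime hk1
      obtain ⟨k', hk'⟩ : p ∣ k := hpdef ▸ Nat.minFac_dvd k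
      have hk'pos : 0 < k' := by
        rcases Nat.eq_zero_or_pos k' with h0 | h0
        · rw [h0, mul_zero] at hk'; omega
        · exact h0
      have hk'lt : k' < k := by
        have := mul_lt_mul_of_pos_right hp.one_lt hk'pos
        rw [one_mul] at this
        omega
      obtain ⟨π₁, hπ₁P, hh⟩ := ih k' hk'lt hk'pos γ hγ
      obtain ⟨π₂, hπ₂P, hh₂⟩ :=
        step p hp (dvd_mul_right N k') (Nat.mul_pos hN hk'pos) P hP (π₁⁻¹ * γ) hh
      refine ⟨π₁ * π₂, P.mul_mem hπ₁P hπ₂P, ?_⟩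
      have e : N * k = N * k' * p := by rw [hk']; ring
      rw [e]
      simpa only [_root_.mul_inv_rev, mul_assoc] using hh₂

/-- **Theorem GL.**  Let `N, M ≥ 1` with `N ∣ M`, and let `P ≤ SL(2,ℤ)` be any subgroup containing every element of `Γ₁(N)` of
trace `2` (i.e. `1` and the parabolic elements of `Γ₁(N)`).  Then `Γ₁(N) ≤ P ⊔ Γ(M)`. -/
theorem Gamma1_le_sup_Gamma {N M : ℕ} (hN : 0 < N) (hM : 0 < M) (hNM : N ∣ M) (P : Subgroup SL(2, ℤ))
    (hP : ∀ γ : SL(2, ℤ), γ ∈ CongruenceSubgroup.Gamma1 N → (γ : Matrix (Fin 2) (Fin 2) ℤ).trace = 2 → γ ∈ P) :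
    CongruenceSubgroup.Gamma1 N ≤ P ⊔ CongruenceSubgroup.Gamma M := by
  obtain ⟨k, rfl⟩ := hNM
  have hk : 0 < k := Nat.pos_of_ne_zero (by rintro rfl; simp at hM)
  intro γ hγ
  obtain ⟨π, hπ, hrest⟩ := exists_mem_inv_mul_mem_Gamma hN P hP k hk γ hγ
  have e : γ = π * (π⁻¹ * γ) := by rw [mul_inv_cancel_left]
  rw [e]
  exact Subgroup.mul_mem_sup hπ hrest

/-- **Theorem GL, closure form.**  `Γ₁(N)` is contained in (indeed equal to) the subgroup generated by its trace-2 elements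
together with `Γ(M)`, for every `M ≥ 1` divisible by `N`. -/
theorem Gamma1_le_closure_parabolic_sup_Gamma {N M : ℕ} (hN : 0 < N) (hM : 0 < M) (hNM : N ∣ M) :
    CongruenceSubgroup.Gamma1 N ≤
      Subgroup.closure {γ : SL(2, ℤ) | γ ∈ CongruenceSubgroup.Gamma1 N ∧ (γ : Matrix (Fin 2) (Fin 2) ℤ).trace = 2}
        ⊔ CongruenceSubgroup.Gamma M :=
  Gamma1_le_sup_Gamma hN hM hNM _ (fun _ h₁ h₂ => Subgroup.subset_closure ⟨h₁, h₂⟩)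

/-- **Corollary GL-a.**  A subgroup of `SL(2,ℤ)` containing some principal congruence subgroup `Γ(M)` (`M ≥ 1`) and every
trace-2 element of `Γ₁(N)` (`N ≥ 1`) contains `Γ₁(N)`.  (In the route: a congruence subgroup containing all parabolic elements
of `Γ₀(N)` contains `Γ₁(N)`, since trace-2 elements of `Γ₁(N) ≤ Γ₀(N)` other than `1` are parabolic.) -/
theorem Gamma1_le_of_Gamma_le {N M : ℕ} (hN : 0 < N) (hM : 0 < M) (Γ' : Subgroup SL(2, ℤ))
    (hΓ : CongruenceSubgroup.Gamma M ≤ Γ')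
    (hpar : ∀ γ : SL(2, ℤ), γ ∈ CongruenceSubgroup.Gamma1 N → (γ : Matrix (Fin 2) (Fin 2) ℤ).trace = 2 → γ ∈ Γ') :
    CongruenceSubgroup.Gamma1 N ≤ Γ' := by
  have h1 := Gamma1_le_sup_Gamma hN (Nat.mul_pos hN hM) (dvd_mul_right N M) Γ' hpar
  have h2 : CongruenceSubgroup.Gamma (N * M) ≤ Γ' := (Gamma_le_Gamma_of_dvd (dvd_mul_left M N)).trans hΓ
  exact h1.trans (sup_le le_rfl h2)

/-- **Corollary GL-a, `Γ₀(N)` form.**  A subgroup containing `Γ(M)` (`M ≥ 1`) and every trace-2 element of `Γ₀(N)` contains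
`Γ₁(N)`. -/
theorem Gamma1_le_of_Gamma_le' {N M : ℕ} (hN : 0 < N) (hM : 0 < M) (Γ' : Subgroup SL(2, ℤ))
    (hΓ : CongruenceSubgroup.Gamma M ≤ Γ')
    (hpar : ∀ γ : SL(2, ℤ), γ ∈ CongruenceSubgroup.Gamma0 N → (γ : Matrix (Fin 2) (Fin 2) ℤ).trace = 2 → γ ∈ Γ') :
    CongruenceSubgroup.Gamma1 N ≤ Γ' :=
  Gamma1_le_of_Gamma_le hN hM Γ' hΓ (fun γ h₁ h₂ => hpar γ (CongruenceSubgroup.Gamma1_in_Gamma0 N h₁) h₂)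

end GLFull
end ManinGamma
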